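import Summits.Ventures.HSemireg.TwoLevelObstructionFrameReduction
import Literature.AlgebraicGeometry.HodgeTheory.BlochSemiregularityMapReal
import Literature.AlgebraicGeometry.Modules.TensorProduct
import HarnessLib

/-!
# Venture HSemireg — THE SEMIREGULARITY HOOK: from Bloch semiregularity of a zero scheme `Z ⊂ P` to row 716's `H2`,
# mod a named dictionary; the census no-go «no class-y two-level design yields a Bloch-semiregular `Z`» in kernel form

HONEST FRAMING. Lean side of the computation cell `pub-hsemireg` (S4-PUSH, H2 door PAD-4; seat s4-prove-1 g29,
2026-08-28; TIER-3, object (c9) of director-hodge R14.18 ∕ R14.19, priced on the cell bus). The H2 skeleton consumes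
the tree predicate `HasBlochSeedAt 4 P h w` (`Literature/AlgebraicGeometry/HodgeTheory/WeilClassesBlochSeed.lean`),
whose load-bearing conjunct is `IsBlochSemiregular i (2·4) 4` (`BlochSemiregularityMapReal.lean`: SURJECTIVITY of the
real-carrier map `blochPairingMap i 3 5 3 : H³(P, Ω⁵_P) →+ H³(P, 𝓐lt₃(𝓘; Ω⁸_P|_Z))`, the transpose of Bloch's `π :
H¹(Z, 𝒩) → H⁵(P, Ω³)`). Files (c3)–(c7) of this seat typed the model→sheaf bridge of row 716 as «classical inputs +
`ObDictionary` ⇒ ((∀ κ, ob_κ(E) = 0) ⇒ `D.H2`)» for a line-bundle realisation of a model design `D`. This file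
supplies the ONE missing interface between the two: a HYPOTHESIS structure `SemiregularityDictionary` whose fields are
exactly the classical ∕ cell identifications that stand between semiregularity of `Z` and the vanishing of `ob_κ(E)`
(director's k0 list, bus l.32728):

* `obZ κ ∈ H¹(Z, 𝒩_{Z∕P})` — the obstruction class of the embedded deformation of `Z` along the direction `κ ∈ T_W`
  (Kodaira–Spencer image of `κ`; Sernesi, *Deformations of algebraic schemes*, §3.2 (embedded deformations of a
  regular embedding: obstructions in `H¹(Z, 𝒩)`); Bloch 1972 §4) — on the
  tree's REAL carrier `normalSheafCohomology i 1`; hypothesis-form (no KS map on real carriers in the tree);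
* `pairing`, `pairing_nondeg` — Serre duality `H¹(Z, 𝒩) × H³(Z, 𝒩^∨ ⊗ ω_Z) → k`, non-degenerate on the left
  (Hartshorne III.7.6–7.7), the second factor read on the tree's target of `blochPairingMap i 3 5 3`
  (`BlochSemiregularityMapReal`: «Not here: Serre duality and hence the transposed map `τ_B` itself»); hypothesis-form;
* `bloch_hodge` — Bloch's formula `π(ob_κ(Z)) = (κ ∪ cl Z)^{3,5}` (Bloch 1972 (6.8), cite-only as in ZL4C §2′;
  Buchweitz–Flenner 2003 §4, Prop. 4.4 ∕ Cor. 4.3) TOGETHER WITH the definition of `T_W` (the directions along which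
  `q·h⁴ + w` stays of type `(4,4)`; in row 716's dictionary every `κ : Matrix (Fin 4) (Fin 4) ℂ` is a `T_W`
  direction), in TRANSPOSED form: `⟨ob_κ(Z), π^t(x)⟩ = 0`;
* `δZ`, `ρ`, `lemmaZE` — LEMMA Z|E of the cell (`s4push/search-1/ZL4C-SCOPING-search-1.md` §2′, pencil ×1; functoriality
  of obstruction classes, Sernesi §3.2): `∂(ob_κ(Z)) = ρ(ob_κ(E))` in `H²(P, E ⊗ 𝓘_Z)` for `Z` the zero scheme of a
  regular section of `E` (`∂` the connecting map of `0 → E ⊗ 𝓘_Z → E → E|_Z → 0`, `ρ = H²(ev_s)`), on the real carrier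
  `moduleSheafCohomology (tensorObj E (idealModule i)) 2`; hypothesis-form;
* `injE` — **(INJ_E)**, the ONE genuine hypothesis ON THE DESIGN (ZL4C §2′: `ρ(ob_κ E) = 0 ⇒ ob_κ E = 0`, a Koszul
  cohomology-vanishing condition expected for the positive designs that carry regular sections; NOT classical, NOT
  proved — a named design hypothesis).

PROVED from these (linear algebra + composition): `obZ_eq_zero_of_isBlochSemiregular` (surjectivity of `π^t` +
non-degeneracy + `bloch_hodge`), `obExt_eq_zero_of_isBlochSemiregular` (`lemmaZE` + `injE`), then with (c7):
**`H2_of_isBlochSemiregular`** — SEMIREGULAR ⇒ row 716's `H2` (H2 is NECESSARY, not sufficient; the converse is NOT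
claimed) — and the census NO-GO **`not_isBlochSemiregular_of_classY`**: for a class-y model design realised by line
bundles with Künneth inputs, `ob`-dictionary, minimal presentation and `(H1)`, the zero scheme `Z` is NOT
Bloch-semiregular — it is not a `HasBlochSeedAt 4` witness (by NAME of the tree predicate's conjunct). A typed
NECESSARY-CONDITION FILTER on candidate carriers, window-independent (parametrised by the realisation `R`, the design
`D`, the immersion `i`). No inhabitant of any hypothesis structure is constructed (no `Z`, no section, no bundle on
`S⁴`); Serre duality and Bloch's
theorem are NOT proved here; no Literature fact (`def … : Prop`), no instance, no notation, no edit of row 716;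
census-neutral. NOTHING HERE SAYS THAT HC ∕ HC_CM ∕ HC_AV ∕ W₆ ∕ HC_Kum4Type HOLDS OR FAILS; `theoremLZeta_holds`
stays a
theorem of the first-order MODEL; (S3) ∕ (S5) status words do not move; nothing here is a statement about
`stub_rung_pad4_seedAt`. Research route conditional on HC_CM; not a corollary.
-/

noncomputable section
namespace Summit.Ventures.HSemireg.TwoLevelObstruction

open CategoryTheory CategoryTheory.Abelian CategoryTheory.Limits AlgebraicGeometry
open Literature.AlgebraicGeometry.HodgeTheory Literature.AlgebraicGeometry.Modules
  Literature.AlgebraicGeometry.Motives Literature.AlgebraicGeometry.Deformation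
open Summit.Ventures.HSemireg.Pad4FirstOrder

universe w u

variable {k : Type u} [CommRing k] (X : Over (Spec (CommRingCat.of k))) [HasExt.{w} X.left.Modules]
  [HasFiniteBiproducts X.left.Modules]

/-! ## §1 The dictionary -/

/-- The TARGET of the transposed Bloch map in codimension `4` on an `8`-fold: `H³(P, 𝓐lt₃(𝓘; Ω⁸_P|_Z))`
(`= H³(Z, Λ³𝒩 ⊗ ω_P|_Z) ≅ H³(Z, 𝒩^∨ ⊗ ω_Z)`, the Serre dual of `H¹(Z, 𝒩)`), i.e. the codomain of the tree's
`blochPairingMap i 3 5 3`. [definition of this file] -/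
abbrev blochTarget {Z : Scheme.{u}} (i : Z ⟶ X.left) : Type u :=
  moduleSheafCohomology (altMultiHom (idealModule i) (formsOnSubscheme i (pairingDegree 3 5)) 3) 3

/-- **The semiregularity dictionary** of a line-bundle realisation `R` of the model design `D` and a morphism
`i : Z ⟶ P` (intended: the closed immersion of the zero scheme of a regular section of the cokernel bundle `R.E`, a
local complete intersection fourfold in the abelian eightfold `P = S⁴`), in degree `n` (`1 + 1 = n`): the
identifications — classical but absent from the tree on real carriers, plus ONE design hypothesis `injE` — under which
Bloch semiregularity of `Z` forces `ob_κ(E) = 0` for every direction `κ ∈ T_W`. HYPOTHESIS structure; no inhabitant is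
constructed. [definition of this file] -/
structure SemiregularityDictionary {D : Design} (R : LineBundleRealisation X D) {n : ℕ} (h : 1 + 1 = n)
    {Z : Scheme.{u}} (i : Z ⟶ X.left) where
  /-- the obstruction class `ob_κ(Z) ∈ H¹(Z, 𝒩_{Z∕P})` to deforming `Z ⊂ P` along the direction `κ`
  (Kodaira–Spencer image of `κ`; Sernesi §3.2), on the real carrier `normalSheafCohomology i 1`. -/
  obZ : Matrix (Fin 4) (Fin 4) ℂ → normalSheafCohomology i 1
  /-- Serre duality pairing `H¹(Z, 𝒩) × H³(Z, 𝒩^∨ ⊗ ω_Z) → k`, the second factor read on the target of the tree's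
  transposed Bloch map (Hartshorne III.7.6–7.7; hypothesis-form). -/
  pairing : normalSheafCohomology i 1 →+ (blochTarget X i →+ k)
  /-- non-degeneracy of the Serre pairing on the left. -/
  pairing_nondeg : ∀ ν : normalSheafCohomology i 1, (∀ y : blochTarget X i, pairing ν y = 0) → ν = 0
  /-- Bloch's formula `π(ob_κ(Z)) = (κ ∪ cl Z)^{3,5}` (Bloch 1972 (6.8); Buchweitz–Flenner 2003 §4) with the
  definition of `T_W` (`cl Z ∈ ℚ h⁴ + ℚ w` stays of type `(4,4)` along every `κ ∈ T_W`), in transposed form: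
  `ob_κ(Z)` pairs to zero with the image of `π^t = blochPairingMap i 3 5 3`. -/
  bloch_hodge : ∀ (κ : Matrix (Fin 4) (Fin 4) ℂ) (x : hodgeCohomology X 5 3),
    pairing (obZ κ) (blochPairingMap i 3 5 3 x) = 0
  /-- the connecting map `∂ : H¹(Z, 𝒩) = H¹(Z, E|_Z) → H²(P, E ⊗ 𝓘_Z)` of `0 → E ⊗ 𝓘_Z → E → E|_Z → 0` (for `Z` the zero
  scheme of a regular section of `E`, `𝒩 ≅ E|_Z`), on real carriers; hypothesis-form. -/
  δZ : normalSheafCohomology i 1 →+ moduleSheafCohomology (tensorObj R.E (idealModule i)) 2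
  /-- `ρ = H²(ev_s) : Ext²(E, E) = H²(𝓔nd E) → H²(P, E ⊗ 𝓘_Z)`, `ev_s(φ) = φ(s)` (ZL4C §2′); hypothesis-form. -/
  ρ : Ext.{w} R.E R.E n →+ moduleSheafCohomology (tensorObj R.E (idealModule i)) 2
  /-- **LEMMA Z|E** (ZL4C-SCOPING §2′, pencil ×1: «the zero locus remembers its bundle»): `∂(ob_κ(Z)) = ρ(ob_κ(E))`,
  with `ob_κ(E) = obExt` of (c5). -/
  lemmaZE : ∀ κ : Matrix (Fin 4) (Fin 4) ℂ, δZ (obZ κ) = ρ (obExt (R.hκ κ) h R.E)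
  /-- **(INJ_E)** — the ONE design hypothesis (ZL4C §2′): `ρ` detects the obstructions `ob_κ(E)` (a Koszul
  cohomology-vanishing condition on the design; NOT classical, NOT proved). -/
  injE : ∀ κ : Matrix (Fin 4) (Fin 4) ℂ, ρ (obExt (R.hκ κ) h R.E) = 0 → obExt (R.hκ κ) h R.E = 0

namespace SemiregularityDictionary

variable {X} {D : Design} {R : LineBundleRealisation X D} {n : ℕ} {h : 1 + 1 = n} {Z : Scheme.{u}} {i : Z ⟶ X.left}

/-! ## §2 Semiregular ⇒ the obstructions vanish -/

/-- **Bloch semiregularity kills the embedded obstructions along `T_W`**: if `Z` is Bloch-semiregular in `P` (`8`-fold,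
codimension `4`: `π^t = blochPairingMap i 3 5 3` surjective) then `ob_κ(Z) = 0` for every direction `κ` — `ob_κ(Z)`
pairs to zero with the (full) image of `π^t`, and the Serre pairing is non-degenerate. -/
theorem obZ_eq_zero_of_isBlochSemiregular (S : SemiregularityDictionary X R h i) (hZ : IsBlochSemiregular i 8 4)
    (κ : Matrix (Fin 4) (Fin 4) ℂ) : S.obZ κ = 0 := by
  have hsurj : Function.Surjective (blochPairingMap i 3 (4 + 1) 3) :=
    (isBlochSemiregular_iff (i := i) (n := 8) (p := 4) (r := 3) (m := 4) (k := 3) rfl rfl rfl).mp hZ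
  refine S.pairing_nondeg _ fun y => ?_
  obtain ⟨x, rfl⟩ := hsurj y
  exact S.bloch_hodge κ x

/-- **Bloch semiregularity of `Z` kills the obstructions of the BUNDLE along `T_W`** (LEMMA Z|E + (INJ_E)):
`ob_κ(E) = At'(E) ≫ c_κ(E) = 0` for every `κ`. -/
theorem obExt_eq_zero_of_isBlochSemiregular (S : SemiregularityDictionary X R h i) (hZ : IsBlochSemiregular i 8 4)
    (κ : Matrix (Fin 4) (Fin 4) ℂ) : obExt (R.hκ κ) h R.E = 0 :=
  S.injE κ (by rw [← S.lemmaZE κ, S.obZ_eq_zero_of_isBlochSemiregular hZ κ, map_zero])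

/-! ## §3 Semiregular ⇒ row 716's `H2`; the census no-go -/

/-- **SEMIREGULAR ⇒ `H2`** (row 716's first-order condition is NECESSARY for a Bloch seed of this shape): for a
line-bundle realisation with Künneth inputs and `ob`-dictionary, and a semiregularity dictionary for `i : Z ⟶ P`, Bloch
semiregularity of `Z` implies `D.H2` at the realisation's sections. The converse is NOT claimed. -/
theorem H2_of_isBlochSemiregular (S : SemiregularityDictionary X R h i) (KI : KunnethInputs X R n)
    (hob : ObDictionary X R KI h) (hZ : IsBlochSemiregular i 8 4) : D.H2 KI.sections :=
  H2_of_realisation_of_forall_obExt_eq_zero R KI hob (S.obExt_eq_zero_of_isBlochSemiregular hZ)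

/-- **THE CENSUS NO-GO IN KERNEL FORM, MOD DICTIONARY**: for a model design of class y (`D.InClassY`) realised by line
bundles (Künneth inputs, `ob`-dictionary, semiregularity dictionary) with minimal presentation and `(H1)`, the scheme
`Z` is NOT Bloch-semiregular in `P` — spelled exactly as the conjunct `IsBlochSemiregular i (2 * 4) 4` of the tree
predicate `HasBlochSeedAt 4 P h w`: such a `Z` is not a Bloch seed. Trust base: `theoremLZeta_holds` (MODEL theorem) +
the named hypothesis structures `KunnethInputs` (classical), `ObDictionary` (classical mod conventions, (c8-DOC)),
`SemiregularityDictionary` (classical fields + LEMMA Z|E + the design hypothesis (INJ_E)). -/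
theorem not_isBlochSemiregular_of_classY (S : SemiregularityDictionary X R h i) (KI : KunnethInputs X R n)
    (hob : ObDictionary X R KI h) (hY : D.InClassY) (hmin : D.Minimal KI.sections) (h1 : D.H1) :
    ¬ IsBlochSemiregular i (2 * 4) 4 :=
  fun hZ => (KunnethLerayFrame.ofRealisation R KI hob).not_forall_obExt_eq_zero hY hmin h1
    (S.obExt_eq_zero_of_isBlochSemiregular hZ)

end SemiregularityDictionary

end Summit.Ventures.HSemireg.TwoLevelObstruction

end
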